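import Literature.AnabelianGeometry.EtaleTheta.SettingModelChiTwistedLatticeSwap
import HarnessLib

/-!
# The χ-twisted root model with an extra Tate lattice, file 1e: the embedding `Π^tp_X(modelχ) ↪ Π^tp_X(modelLat)`,
# `(γ; σ) ↦ ((γ, 1); σ)` — the slice `t = 1` (input of file 2, the Kummer core of `modelLat`)

Mochizuki, *The étale theta function …*, Publ. RIMS **45** (2009) [EtTh], §1, PRIMS PDF pp. 12–14
[cite: MochizukiEtTh2009, §1 p.12].

LATTICE TWIST OF `Ẑ(1)²` — NOT the (B) section twist (cf. file 1, `SettingModelChiTwistedLattice.lean`, and abc-iut-L2-lead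
R709).  abc-iut cell, K-L6 slice, row «KL6-CLOSURE-CERT F-2633», seat abc-iut-L6-t19 (gen 8).  Over files 1–1d and abc-iut-L2-t1's
χ-model (`PiTpχ`, `YNχ`, `chiTwistData`, `curveχ`) BY NAME:

* `iotaGfp : Γ →ₜ* Γ × Latt`, `γ ↦ (γ, 1)` (equivariant: `actLatt σ 1 = 1`); **`iotaPi p : PiTpχ p →ₜ* PiTpLat p`**, `(γ;σ) ↦ ((γ,1);σ)`
  (`Semidirect.mapCont`), injective; the profinite companion `iotaPiHat : PiHtχ p →ₜ* PiHtLat p` with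
  `toHatLat ∘ iotaPi = iotaPiHat ∘ toHatχ`;
* the slice dictionary: `toZLat (iotaPi g) = toZχ g`, **`iotaPi_mem_YNLat_iff : iotaPi g ∈ Π□_{Y_N} ↔ g ∈ Π^tp_{Y_N}(modelχ)`**
  (`ψ_N(γ, 1) = y_N(γ)`; on degree `0` the `x`-level vanishes), `iotaPi g ∈ Δ^tp(curveLat) ↔ g ∈ Δ^tp(curveχ)`;
* `map_iotaPiHat_deltaHat_le : iotaPiHat(Δ_X(curveχ)) ≤ Δ_X(curveLat)` and the forward transport of the theta / ell kernels
  **`iotaPi_mem_thetaKer`**, **`iotaPi_mem_ellKer`** (continuous images of closures of commutator subgroups) — so `iotaPi`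
  induces a homomorphism `Δ_Θ(curveχ) → Δ_Θ(curveLat)` on the theta centres (file 2 upgrades it to the coefficient
  isomorphism of the Kummer core).

HONEST LABEL: semi-synthetic model bookkeeping (consistency/independence evidence for OUR typed interface only); nothing of
[EtTh] asserted; no side taken on [IUTchIII] Cor. 3.12.  Class (b) construction file (def-bearing: `iotaGfp`, `iotaPi`,
`iotaGfpHat`, `iotaPiHat`; no instance, no notation, no Prop-valued def).
-/

noncomputable section

namespace Literature.AnabelianGeometry.EtaleTheta.SettingModel

open Literature.AnabelianGeometry.SemiGraphs _root_.Topology _root_.Function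
open scoped commutatorElement

variable (p : ℕ) [Fact p.Prime]

/-! ### The embedding `(γ; σ) ↦ ((γ, 1); σ)` -/

/-- `γ ↦ (γ, 1) : Γ → Γ × Latt`, continuous homomorphism. [cite: MochizukiEtTh2009, §1 p.12] -/
def iotaGfp : Gfp →ₜ* GfpLat where
  toMonoidHom := MonoidHom.inl Gfp Latt
  continuous_toFun := continuous_id.prodMk continuous_const

/-- [cite: MochizukiEtTh2009, §1 p.12] -/
@[simp] theorem iotaGfp_apply (γ : Gfp) : iotaGfp γ = (γ, 1) := rfl

/-- `γ ↦ (γ, 1)` intertwines `actχ` and `actLat`. [cite: MochizukiEtTh2009, §1 p.12] -/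
theorem iotaGfp_actχ (σ : GQp p) (γ : Gfp) : iotaGfp (actχ p σ γ) = actLat p σ (iotaGfp γ) := by
  rw [iotaGfp_apply, iotaGfp_apply, actLat_apply, map_one]

/-- **`Π^tp_X(modelχ) → Π^tp_X(modelLat)`**, `(γ; σ) ↦ ((γ, 1); σ)`. [cite: MochizukiEtTh2009, §1 p.12] -/
def iotaPi : PiTpχ p →ₜ* PiTpLat p :=
  Semidirect.mapCont (isInducing_leftRightχ p) (isInducing_leftRightLat p) iotaGfp (iotaGfp_actχ p)

/-- [cite: MochizukiEtTh2009, §1 p.12] -/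
@[simp] theorem iotaPi_left (g : PiTpχ p) : (iotaPi p g).left = (g.left, 1) := rfl

/-- [cite: MochizukiEtTh2009, §1 p.12] -/
@[simp] theorem iotaPi_right (g : PiTpχ p) : (iotaPi p g).right = g.right := rfl

/-- The embedding is injective. [cite: MochizukiEtTh2009, §1 p.12] -/
theorem iotaPi_injective : Injective (iotaPi p) :=
  Semidirect.mapCont_injective _ _ _ _ fun a b h => by simpa using congrArg Prod.fst h

/-- `x ↦ (x, 1) : F̂₂ → F̂₂ × Latt`, continuous homomorphism. [cite: MochizukiEtTh2009, §1 p.12] -/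
def iotaGfpHat : F₂hatT →ₜ* GfpLatHat where
  toMonoidHom := MonoidHom.inl F₂hatT Latt
  continuous_toFun := continuous_id.prodMk continuous_const

/-- [cite: MochizukiEtTh2009, §1 p.12] -/
@[simp] theorem iotaGfpHat_apply (x : F₂hatT) : iotaGfpHat x = (x, 1) := rfl

/-- `x ↦ (x, 1)` intertwines `actHatχ` and `actLatHat`. [cite: MochizukiEtTh2009, §1 p.12] -/
theorem iotaGfpHat_actHatχ (σ : GQp p) (x : F₂hatT) : iotaGfpHat (actHatχ p σ x) = actLatHat p σ (iotaGfpHat x) := by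
  rw [iotaGfpHat_apply, iotaGfpHat_apply, actLatHat_apply, map_one]

/-- The profinite companion `Π_X(modelχ) → Π_X(modelLat)`, `(x; σ) ↦ ((x, 1); σ)`. [cite: MochizukiEtTh2009, §1 p.12] -/
def iotaPiHat : PiHtχ p →ₜ* PiHtLat p :=
  Semidirect.mapCont (isInducing_leftRightHatχ p) (isInducing_leftRightHatLat p) iotaGfpHat (iotaGfpHat_actHatχ p)

/-- [cite: MochizukiEtTh2009, §1 p.12] -/
@[simp] theorem iotaPiHat_left (g : PiHtχ p) : (iotaPiHat p g).left = (g.left, 1) := rfl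

/-- [cite: MochizukiEtTh2009, §1 p.12] -/
@[simp] theorem iotaPiHat_right (g : PiHtχ p) : (iotaPiHat p g).right = g.right := rfl

/-- `toHat ∘ iotaPi = iotaPiHat ∘ toHat`. [cite: MochizukiEtTh2009, §1 p.12] -/
theorem toHatLat_iotaPi (g : PiTpχ p) : toHatLat p (iotaPi p g) = iotaPiHat p (toHatχ p g) :=
  SemidirectProduct.ext rfl rfl

/-! ### The slice dictionary: degree, `Δ^tp`, `Π_{Y_N}` -/

/-- `toZ` is unchanged along the embedding. [cite: MochizukiEtTh2009, §1 p.12] -/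
theorem toZLat_iotaPi (g : PiTpχ p) : toZLat p (iotaPi p g) = (chiTwistData p).toZ g := rfl

/-- `Δ^tp` is respected along the embedding. [cite: MochizukiEtTh2009, §1 p.12] -/
theorem iotaPi_mem_deltaTemp_iff (g : PiTpχ p) : iotaPi p g ∈ (curveLat p).DeltaTemp ↔ g ∈ (curveχ p).DeltaTemp := by
  rw [mem_deltaTempLat_iff, mem_deltaTempχ_iff, iotaPi_right]

/-- `ψ_N(γ, 1) = y_N(γ)`. [cite: MochizukiEtTh2009, §1 p.13] -/
theorem toAdd_psiLat_iotaGfp (N : ℕ+) (γ : Gfp) :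
    Multiplicative.toAdd (psiLat N (iotaGfp γ)) = (levelHom N γ).y := by
  rw [toAdd_psiLat, iotaGfp_apply]
  change (levelHom N γ).y + Multiplicative.toAdd (ZHatLevel.level N (1 : ZH)) = (levelHom N γ).y
  rw [map_one, toAdd_one, add_zero]

/-- `(γ, 1) ∈ Δ□_{Y_N} ↔ γ ∈ Δ^tp_{Y_N}` (on degree `0` the `x`-level vanishes, abc-iut-L2-t1's `levelHom_x_eq_zero`).
[cite: MochizukiEtTh2009, §1 p.13] -/
theorem iotaGfp_mem_AYLat_iff (N : ℕ+) (γ : Gfp) : iotaGfp γ ∈ AYLat N ↔ γ ∈ dY N := by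
  rw [mem_AYLat_iff, dY, Subgroup.mem_inf, Subgroup.mem_comap]
  constructor
  · rintro ⟨h1, h2⟩
    have hdeg : γ ∈ gfpSnd.ker := h1
    refine ⟨hdeg, levelHom_x_eq_zero hdeg, ?_⟩
    have h2' := congrArg Multiplicative.toAdd h2
    rw [toAdd_psiLat_iotaGfp, toAdd_one] at h2'
    exact h2'
  · rintro ⟨h1, -, hy⟩
    refine ⟨h1, ?_⟩
    apply Multiplicative.toAdd.injective
    rw [toAdd_psiLat_iotaGfp, toAdd_one]
    exact hy

/-- **`iotaPi g ∈ Π□_{Y_N} ↔ g ∈ Π^tp_{Y_N}(modelχ)`.** [cite: MochizukiEtTh2009, §1 p.13] -/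
theorem iotaPi_mem_YNLat_iff (N : ℕ+) (g : PiTpχ p) : iotaPi p g ∈ YNLat p N ↔ g ∈ YNχ p N := by
  rw [mem_YNLat_iff, iotaPi_left, iotaPi_right]
  change iotaGfp g.left ∈ AYLat N ∧ _ ↔ _
  rw [iotaGfp_mem_AYLat_iff]
  exact ((chiTwistData p).mem_YN).symm

/-! ### Forward transport of the closed commutator kernels -/

/-- `iotaPiHat(Δ_X(curveχ)) ≤ Δ_X(curveLat)` (continuous image of a closure). [cite: MochizukiEtTh2009, §1 p.12] -/
theorem map_iotaPiHat_deltaHat_le :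
    ((curveχ p).DeltaHat).map (iotaPiHat p).toMonoidHom ≤ (curveLat p).DeltaHat := by
  -- the image of the dense part lands in the dense part
  have h0 : ((curveχ p).DeltaTemp.map (curveχ p).toHat.toMonoidHom).map (iotaPiHat p).toMonoidHom ≤
      (curveLat p).DeltaTemp.map (curveLat p).toHat.toMonoidHom := by
    rintro _ ⟨_, ⟨g, hg, rfl⟩, rfl⟩
    refine ⟨iotaPi p g, (iotaPi_mem_deltaTemp_iff p g).mpr hg, ?_⟩
    change toHatLat p (iotaPi p g) = iotaPiHat p (toHatχ p g)
    exact toHatLat_iotaPi p g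
  -- closures: `f(closure A) ≤ closure (f A) ≤ closure B`
  refine (Subgroup.map_mono le_rfl).trans ?_
  change ((curveχ p).DeltaTemp.map (curveχ p).toHat.toMonoidHom).topologicalClosure.map (iotaPiHat p).toMonoidHom ≤
    ((curveLat p).DeltaTemp.map (curveLat p).toHat.toMonoidHom).topologicalClosure
  intro y hy
  obtain ⟨x, hx, rfl⟩ := hy
  have hx' : (iotaPiHat p) x ∈ closure ((iotaPiHat p) '' (((curveχ p).DeltaTemp.map (curveχ p).toHat.toMonoidHom :
      Subgroup (PiHtχ p)) : Set (PiHtχ p))) :=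
    image_closure_subset_closure_image (iotaPiHat p).continuous ⟨x, hx, rfl⟩
  have hsub : (iotaPiHat p) '' (((curveχ p).DeltaTemp.map (curveχ p).toHat.toMonoidHom : Subgroup (PiHtχ p)) :
      Set (PiHtχ p)) ⊆ (((curveLat p).DeltaTemp.map (curveLat p).toHat.toMonoidHom : Subgroup (PiHtLat p)) :
        Set (PiHtLat p)) := by
    rintro _ ⟨z, hz, rfl⟩
    exact h0 ⟨z, hz, rfl⟩
  have key := closure_mono hsub hx'
  rwa [← Subgroup.topologicalClosure_coe] at key

/-- Continuous image of the closure of a commutator of subgroups lies in the closure of the commutator of the images' bounds.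
[folklore] -/
private theorem map_closure_commutator_le {A B : Type*} [Group A] [TopologicalSpace A] [IsTopologicalGroup A]
    [Group B] [TopologicalSpace B] [IsTopologicalGroup B] (f : A →ₜ* B) {H K : Subgroup A} {H' K' : Subgroup B}
    (hH : H.map f.toMonoidHom ≤ H') (hK : K.map f.toMonoidHom ≤ K') :
    (⁅H, K⁆.topologicalClosure).map f.toMonoidHom ≤ (⁅H', K'⁆).topologicalClosure := by
  have h1 : (⁅H, K⁆).map f.toMonoidHom ≤ ⁅H', K'⁆ := by
    rw [Subgroup.map_commutator]
    exact Subgroup.commutator_mono hH hK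
  intro y hy
  obtain ⟨x, hx, rfl⟩ := hy
  have hx' : f x ∈ closure (f '' ((⁅H, K⁆ : Subgroup A) : Set A)) :=
    image_closure_subset_closure_image f.continuous ⟨x, hx, rfl⟩
  have hsub : f '' ((⁅H, K⁆ : Subgroup A) : Set A) ⊆ ((⁅H', K'⁆ : Subgroup B) : Set B) := by
    rintro _ ⟨z, hz, rfl⟩
    exact h1 ⟨z, hz, rfl⟩
  have key := closure_mono hsub hx'
  rwa [← Subgroup.topologicalClosure_coe] at key

/-- **Forward transport of the theta kernel**: `g ∈ Ker(Π^tp_X(modelχ) ↠ (·)^Θ) ⇒ iotaPi g ∈ Ker(Π^tp_X(modelLat) ↠ (·)^Θ)`.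
[cite: MochizukiEtTh2009, §1 p.12] -/
theorem iotaPi_mem_thetaKer {g : PiTpχ p} (hg : g ∈ CurveTheta.thetaKer (curveχ p)) :
    iotaPi p g ∈ CurveTheta.thetaKer (curveLat p) := by
  have hΔ := map_iotaPiHat_deltaHat_le p
  have h2 : (⁅(curveχ p).DeltaHat, (curveχ p).DeltaHat⁆).map (iotaPiHat p).toMonoidHom ≤
      ⁅(curveLat p).DeltaHat, (curveLat p).DeltaHat⁆ := by
    rw [Subgroup.map_commutator]
    exact Subgroup.commutator_mono hΔ hΔ
  have h3 := map_closure_commutator_le (iotaPiHat p) h2 hΔ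
  have hmem : toHatχ p g ∈
      (⁅⁅(curveχ p).DeltaHat, (curveχ p).DeltaHat⁆, (curveχ p).DeltaHat⁆).topologicalClosure := hg
  show toHatLat p (iotaPi p g) ∈
    (⁅⁅(curveLat p).DeltaHat, (curveLat p).DeltaHat⁆, (curveLat p).DeltaHat⁆).topologicalClosure
  rw [toHatLat_iotaPi]
  exact h3 ⟨toHatχ p g, hmem, rfl⟩

/-- **Forward transport of the ell kernel**: `g ∈ Ker(Π^tp_X(modelχ) ↠ (·)^ell) ⇒ iotaPi g ∈ Ker(Π^tp_X(modelLat) ↠ (·)^ell)`.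
[cite: MochizukiEtTh2009, §1 p.12] -/
theorem iotaPi_mem_ellKer {g : PiTpχ p} (hg : g ∈ CurveTheta.ellKer (curveχ p)) :
    iotaPi p g ∈ CurveTheta.ellKer (curveLat p) := by
  have hΔ := map_iotaPiHat_deltaHat_le p
  have h3 := map_closure_commutator_le (iotaPiHat p) hΔ hΔ
  have hmem : toHatχ p g ∈ (⁅(curveχ p).DeltaHat, (curveχ p).DeltaHat⁆).topologicalClosure := hg
  show toHatLat p (iotaPi p g) ∈ (⁅(curveLat p).DeltaHat, (curveLat p).DeltaHat⁆).topologicalClosure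
  rw [toHatLat_iotaPi]
  exact h3 ⟨toHatχ p g, hmem, rfl⟩

end Literature.AnabelianGeometry.EtaleTheta.SettingModel

end
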